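import Mathlib
import Summits.ResolutionOfSingularities.ResolutionOfSingularities.Theorems.WildQuotientsWildQuotientResolutionInitialFormInjective
import Summits.ResolutionOfSingularities.ResolutionOfSingularities.Theorems.WildQuotientsWildQuotientResolutionToricExitRootSubstInjective
import Summits.ResolutionOfSingularities.ResolutionOfSingularities.Theorems.WildQuotientsWildQuotientResolutionJordanFourTwistedChart

/-!
# V4U pieces 0 and T — the slot substitutions `(ρ, N, c′, d′)` and `(s, A, N)` are injective

(crux stmt-ResolutionOfSingularities-15640 `WildQuotients.WildQuotientResolution`, line `Sketch`,
sector `|G| = p`; programme V4U of `L/w45c/CHAIN.md` v7.1 §4 row stub-1 (B0-b «U₀^Σ = k[ρ, c′, d′,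
pass][N] as a weighted polynomial ring»; T1 «even ∩ fixed = the ½(1,1,1)-cone») and
`L/w45c/V4U-DESIGN.md` §2/§3. [OURS · L1 W4.5c] — NOT a statement of any manuscript; replaces the
role of no printed item. Prover res-L1-w45c-stub-1.)

The invariant rings of the two singular pieces are images `θ(R)` of res-L1-w45c-stub-4's presentation
ranges (`Third112.presentation`, `Half111.presentation`) under SLOT SUBSTITUTIONS `θ = aeval g`
(`JordanFour.chart0_fixedPoints_eq_*`, `JordanFour.translate_fixedPoints_inter_even_eq`). For the
cone-brick discharges (res-L1-w45c-stub-3, row E) `θ` must be INJECTIVE, so that `R ≃ θ(R)`: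
* `aeval_neg_twist_injective` — `X b ↦ −X a^e·X b` (rest fixed) is injective (res-L1-w45c-stub-2's
  `ToricExit.twist_injective`, p489384, and a sign).
* `slotSubstT_injective` — piece T: `X c ↦ N_c = X c^p − X b^{p−1} X c`, rest fixed (`p ≥ 2`):
  initial form `−X b^{p−1}X c` for the weight «degree in `X c`», then
  `JordanFour.aeval_injective_of_initialForms` (p502667).
* `slotSubst0_injective` — piece 0: `X b ↦ N = X b^p − X a^{p−1} X b`, `X c ↦ c′`, `X d ↦ d′`,
  rest fixed (`char k = p ≥ 5`): initial forms `X a, −X a^{p−1}X b, X c, X d, X i` for the weight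
  «degree in `X b`».
So `ρ, N, c′, d′, passengers` (resp. `s, A, N_c, η, passengers`) are algebraically independent.
-/

-- single-problem summit: the doubled namespace component `ResolutionOfSingularities` is forced
set_option linter.dupNamespace false

noncomputable section

open MvPolynomial

namespace Summit.ResolutionOfSingularities.ResolutionOfSingularities.Theorems.WildQuotientResolution.JordanFour

section ArtinSchreierSlot

variable (k : Type) [Field k] (n : ℕ) (a b : Fin n) (hab : a ≠ b)

include hab in
/-- **The twist `X b ↦ −X a^{e}·X b` (rest fixed) is injective.** [folklore] -/
theorem aeval_neg_twist_injective (e : ℕ) :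
    Function.Injective (aeval (fun i : Fin n => if i = b then -(X a ^ e * X b)
      else (X i : MvPolynomial (Fin n) k)) : MvPolynomial (Fin n) k →ₐ[k] MvPolynomial (Fin n) k) := by
  classical
  let ex : Fin n → ℕ := fun s => if s = b then e else 0
  let tw : MvPolynomial (Fin n) k →ₐ[k] MvPolynomial (Fin n) k :=
    aeval fun s => if s = a then X a else X s * X a ^ ex s
  let sg : MvPolynomial (Fin n) k →ₐ[k] MvPolynomial (Fin n) k :=
    aeval fun s => if s = b then -X b else X s
  have hsgb : sg (X b) = -X b := by simp [sg]
  have hsgi : ∀ i, i ≠ b → sg (X i) = X i := by intro i hi; simp [sg, hi]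
  have htwb : tw (X b) = X b * X a ^ e := by simp [tw, ex, Ne.symm hab]
  have htwi : ∀ i, i ≠ b → tw (X i) = X i := by
    intro i hi
    by_cases hia : i = a
    · rw [hia]; simp [tw]
    · simp [tw, ex, hi, hia]
  have htw : Function.Injective tw := ToricExit.twist_injective k n a ex
  have hsg : Function.Injective sg := by
    have hinv : ∀ f, sg (sg f) = f := by
      intro f
      have key : sg.comp sg = AlgHom.id k _ := by
        refine MvPolynomial.algHom_ext fun i => ?_
        change sg (sg (X i)) = X i
        by_cases hib : i = b
        · rw [hib, hsgb, map_neg, hsgb, neg_neg]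
        · rw [hsgi i hib, hsgi i hib]
      exact congrArg (fun φ : MvPolynomial (Fin n) k →ₐ[k] MvPolynomial (Fin n) k => φ f) key
    exact Function.LeftInverse.injective hinv
  have hcomp : (aeval (fun i : Fin n => if i = b then -(X a ^ e * X b)
      else (X i : MvPolynomial (Fin n) k)) : MvPolynomial (Fin n) k →ₐ[k] MvPolynomial (Fin n) k) =
        tw.comp sg := by
    refine MvPolynomial.algHom_ext fun i => ?_
    rw [aeval_X, AlgHom.comp_apply]
    by_cases hib : i = b
    · rw [hib, if_pos rfl, hsgb, map_neg, htwb]; ring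
    · rw [if_neg hib, hsgi i hib, htwi i hib]
  rw [hcomp]
  exact htw.comp hsg

end ArtinSchreierSlot

section PieceT

variable (k : Type) [Field k] (n : ℕ) (b c : Fin n) (hbc : b ≠ c)

include hbc in
/-- **Piece T: the slot substitution `X c ↦ N_c = X c^p − X b^{p−1} X c` (rest fixed) is injective**
(`p ≥ 2`); hence `s, A, N_c, η, passengers` are algebraically independent. [OURS · L1 W4.5c] -/
theorem slotSubstT_injective (p : ℕ) (hp : 2 ≤ p) :
    Function.Injective (aeval (fun i : Fin n => if i = c then X c ^ p - X b ^ (p - 1) * X c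
      else (X i : MvPolynomial (Fin n) k)) : MvPolynomial (Fin n) k →ₐ[k] MvPolynomial (Fin n) k) := by
  classical
  set F : Fin n → MvPolynomial (Fin n) k := fun i : Fin n => if i = c then X c ^ p - X b ^ (p - 1) * X c
      else (X i : MvPolynomial (Fin n) k) with hF
  have hFc : F c = X c ^ p - X b ^ (p - 1) * X c := by rw [hF]; simp
  have hFi : ∀ i, i ≠ c → F i = X i := by intro i hic; rw [hF]; simp [hic]
  let w : Fin n → ℕ := fun i => if i = c then 1 else 0
  have hwc : w c = 1 := by simp [w]
  have hw0 : ∀ i, i ≠ c → w i = 0 := fun i hic => by simp [w, hic]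
  have hXc : IsWeightedHomogeneous w (X c : MvPolynomial (Fin n) k) 1 :=
    hwc ▸ isWeightedHomogeneous_X k w c
  have hX0 : ∀ i, i ≠ c → IsWeightedHomogeneous w (X i : MvPolynomial (Fin n) k) 0 := by
    intro i hic
    have h := isWeightedHomogeneous_X k w i
    rwa [hw0 i hic] at h
  let g₀ : Fin n → MvPolynomial (Fin n) k := fun i => if i = c then -(X b ^ (p - 1) * X c) else X i
  have hg₀c : g₀ c = -(X b ^ (p - 1) * X c) := by simp [g₀]
  have hg₀i : ∀ i, i ≠ c → g₀ i = X i := by intro i hic; simp [g₀, hic]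
  have h₀ : ∀ i, IsWeightedHomogeneous w (g₀ i) (w i) := by
    intro i
    by_cases hic : i = c
    · rw [hic, hg₀c, hwc]
      have h := ((hX0 b hbc).pow (p - 1)).mul hXc
      rw [smul_zero, zero_add] at h
      exact (weightedHomogeneousSubmodule k w 1).neg_mem h
    · rw [hg₀i i hic, hw0 i hic]
      exact hX0 i hic
  have hr : ∀ i d', coeff d' (F i - g₀ i) ≠ 0 → w i + 1 ≤ Finsupp.weight w d' := by
    intro i
    by_cases hic : i = c
    · rw [hic, hFc, hg₀c, hwc]
      have e0 : (X c ^ p - X b ^ (p - 1) * X c - -(X b ^ (p - 1) * X c) : MvPolynomial (Fin n) k) =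
          X c ^ p * 1 := by ring
      rw [e0]
      refine lb_mul_of_isWeightedHomogeneous_left w (hXc.pow p) ?_ _
      rw [smul_eq_mul, mul_one]; exact hp
    · rw [hFi i hic, hg₀i i hic, sub_self]
      intro d' hd'; rw [coeff_zero] at hd'; exact absurd rfl hd'
  have hinj := aeval_neg_twist_injective k n b c hbc (p - 1)
  exact aeval_injective_of_initialForms w w F g₀ h₀ hr hinj

end PieceT

section PieceZero

variable (k : Type) [Field k] (n : ℕ) (a b c d : Fin n)
  (hab : a ≠ b) (hbc : b ≠ c) (hbd : b ≠ d) (hcd : c ≠ d)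

include hab hbc hbd hcd in
/-- **Piece 0: the slot substitution `X b ↦ N`, `X c ↦ c′`, `X d ↦ d′` (rest fixed) is injective**
(`p` prime, `char k = p ≥ 5`); hence `ρ, N, c′, d′, passengers` are algebraically independent and
`U₀^{σ_U} = k[ρ, c′, d′, passengers][N]` is a (weighted) polynomial ring. [OURS · L1 W4.5c] -/
theorem slotSubst0_injective (p : ℕ) (hp : p.Prime) (hp5 : 5 ≤ p) [CharP k p] :
    Function.Injective (aeval (fun i : Fin n => if i = b then X b ^ p - X a ^ (p - 1) * X b
          else if i = c then C (2⁻¹ : k) * (2 * X c - X b ^ 2 + X a * X b)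
          else if i = d then X d - (C (2⁻¹ : k) * (2 * X c - X b ^ 2 + X a * X b)) * X b -
            C (6⁻¹ : k) * (X b ^ 3 - 3 * (X a * X b ^ 2) + 2 * (X a ^ 2 * X b))
          else (X i : MvPolynomial (Fin n) k)) :
          MvPolynomial (Fin n) k →ₐ[k] MvPolynomial (Fin n) k) := by
  classical
  have h2 : (2 : k) ≠ 0 := two_ne_zero_of_charP k p hp5
  have h2u : (2 : MvPolynomial (Fin n) k) * C (2⁻¹ : k) = 1 := two_mul_C_inv_two k n h2
  set F : Fin n → MvPolynomial (Fin n) k := fun i : Fin n => if i = b then X b ^ p - X a ^ (p - 1) * X b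
          else if i = c then C (2⁻¹ : k) * (2 * X c - X b ^ 2 + X a * X b)
          else if i = d then X d - (C (2⁻¹ : k) * (2 * X c - X b ^ 2 + X a * X b)) * X b -
            C (6⁻¹ : k) * (X b ^ 3 - 3 * (X a * X b ^ 2) + 2 * (X a ^ 2 * X b))
          else (X i : MvPolynomial (Fin n) k) with hF
  have hFb : F b = X b ^ p - X a ^ (p - 1) * X b := by rw [hF]; simp
  have hFc : F c = C (2⁻¹ : k) * (2 * X c - X b ^ 2 + X a * X b) := by
    rw [hF]; simp [Ne.symm hbc]
  have hFd : F d = X d - (C (2⁻¹ : k) * (2 * X c - X b ^ 2 + X a * X b)) * X b -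
      C (6⁻¹ : k) * (X b ^ 3 - 3 * (X a * X b ^ 2) + 2 * (X a ^ 2 * X b)) := by
    rw [hF]; simp [Ne.symm hbd, Ne.symm hcd]
  have hFi : ∀ i, i ≠ b → i ≠ c → i ≠ d → F i = X i := by
    intro i hib hic hid; rw [hF]; simp [hib, hic, hid]
  let w : Fin n → ℕ := fun i => if i = b then 1 else 0
  have hwb : w b = 1 := by simp [w]
  have hw0 : ∀ i, i ≠ b → w i = 0 := fun i hib => by simp [w, hib]
  have hXb : IsWeightedHomogeneous w (X b : MvPolynomial (Fin n) k) 1 :=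
    hwb ▸ isWeightedHomogeneous_X k w b
  have hX0 : ∀ i, i ≠ b → IsWeightedHomogeneous w (X i : MvPolynomial (Fin n) k) 0 := by
    intro i hib
    have h := isWeightedHomogeneous_X k w i
    rwa [hw0 i hib] at h
  let g₀ : Fin n → MvPolynomial (Fin n) k := fun i => if i = b then -(X a ^ (p - 1) * X b) else X i
  have hg₀b : g₀ b = -(X a ^ (p - 1) * X b) := by simp [g₀]
  have hg₀i : ∀ i, i ≠ b → g₀ i = X i := by intro i hib; simp [g₀, hib]
  have h₀ : ∀ i, IsWeightedHomogeneous w (g₀ i) (w i) := by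
    intro i
    by_cases hib : i = b
    · rw [hib, hg₀b, hwb]
      have h := ((hX0 a hab).pow (p - 1)).mul hXb
      rw [smul_zero, zero_add] at h
      exact (weightedHomogeneousSubmodule k w 1).neg_mem h
    · rw [hg₀i i hib, hw0 i hib]
      exact hX0 i hib
  have hr : ∀ i d', coeff d' (F i - g₀ i) ≠ 0 → w i + 1 ≤ Finsupp.weight w d' := by
    intro i
    by_cases hib : i = b
    · rw [hib, hFb, hg₀b, hwb]
      have e0 : (X b ^ p - X a ^ (p - 1) * X b - -(X a ^ (p - 1) * X b) : MvPolynomial (Fin n) k) =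
          X b ^ p * 1 := by ring
      rw [e0]
      refine lb_mul_of_isWeightedHomogeneous_left w (hXb.pow p) ?_ _
      rw [smul_eq_mul, mul_one]; exact hp.two_le
    by_cases hic : i = c
    · rw [hic, hFc, hg₀i c (Ne.symm hbc), hw0 c (Ne.symm hbc)]
      have e0 : (C (2⁻¹ : k) * (2 * X c - X b ^ 2 + X a * X b) - X c : MvPolynomial (Fin n) k) =
          X b * (C (2⁻¹ : k) * (X a - X b)) := by
        linear_combination (X c : MvPolynomial (Fin n) k) * h2u
      rw [e0]
      exact lb_mul_of_isWeightedHomogeneous_left w hXb (by norm_num) _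
    by_cases hid : i = d
    · rw [hid, hFd, hg₀i d (Ne.symm hbd), hw0 d (Ne.symm hbd)]
      have e0 : (X d - (C (2⁻¹ : k) * (2 * X c - X b ^ 2 + X a * X b)) * X b -
          C (6⁻¹ : k) * (X b ^ 3 - 3 * (X a * X b ^ 2) + 2 * (X a ^ 2 * X b)) - X d :
            MvPolynomial (Fin n) k) =
          X b * (-(C (2⁻¹ : k) * (2 * X c - X b ^ 2 + X a * X b)) -
            C (6⁻¹ : k) * (X b ^ 2 - 3 * (X a * X b) + 2 * X a ^ 2)) := by ring
      rw [e0]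
      exact lb_mul_of_isWeightedHomogeneous_left w hXb (by norm_num) _
    · rw [hFi i hib hic hid, hg₀i i hib, sub_self]
      intro d' hd'; rw [coeff_zero] at hd'; exact absurd rfl hd'
  have hinj := aeval_neg_twist_injective k n a b hab (p - 1)
  exact aeval_injective_of_initialForms w w F g₀ h₀ hr hinj

end PieceZero

end Summit.ResolutionOfSingularities.ResolutionOfSingularities.Theorems.WildQuotientResolution.JordanFour

end
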